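import Literature.NumberTheory.EllipticCurves.EisensteinNumbers
import Literature.NumberTheory.EllipticCurves.WeierstrassZetaLegendre
import Mathlib.Algebra.Module.ZLattice.Covolume
import Mathlib.MeasureTheory.Measure.Lebesgue.Complex
import HarnessLib

/-!
# de Shalit's `A(L) = π⁻¹·Area(ℂ/L)`: the conjugate-linear coefficient of the quasi-period map,
# evaluated for every period pair (II.2.1 (4), (6))

Topic `NumberTheory/EllipticCurves` (theorems only; no definition, no named fact, no `sorry`).

The tree's `PeriodPair.areaInv L` (`EisensteinNumbers.lean`) is DEFINED abstractly, as the
conjugate-linear coefficient `(η(1) + iη(i))/2` of the `ℝ`-linear quasi-period map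
`η(z, L) = s₂(L)·z + A(L)⁻¹·z̄` (de Shalit II.2.1, display after (6); Rubin LNM 1716 Def. 7.9), and
enters de Shalit's two-index Eisenstein–Kronecker numbers as the factor `A(L)^{−j}`
(`PeriodPair.eisensteinKronecker`, II.3.1 (6)). De Shalit II.2.1 (4) names the constant:
"`A(L) = (2πi)⁻¹(ω₁ω̄₂ − ω̄₁ω₂) = π⁻¹ Area(ℂ/L)`", and recovers from (6) "Legendre's relation
`ω₁η₂ − ω₂η₁ = 2πi`, and also (using (4)) `η(z, L) = A(L)⁻¹z̄ + s₂(L)z`". This file proves the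
identification, for EVERY period pair (either orientation):

* `PeriodPair.η₁_mul_ω₂_sub_η₂_mul_ω₁` — `η₁ω₂ − η₂ω₁ = A(L)⁻¹·2i·Im(ω̄₁ω₂)` (the `s₂`-parts of
  `η(ωᵢ) = s₂ωᵢ + A⁻¹ω̄ᵢ`, `quasiPeriodMap_apply_eq`, cancel);
* `PeriodPair.areaInv_eq_pi_div_abs_im` — **`A(L)⁻¹ = π / |Im(ω̄₁ ω₂)|`**
  (`|Im(ω̄₁ω₂)| = Area(ℂ/L)`), from the tree's Legendre relation (`legendre_relation_holds` /
  `legendre_relation_of_neg`); `areaInv_mul_covolume_eq_pi`, `areaInv_eq_pi_div_covolume` — the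
  same with Mathlib's `ZLattice.covolume` (Lebesgue area of a fundamental parallelogram);
* hence `A(L)⁻¹` is a positive real number (`areaInv_eq_ofReal`, `areaInv_ne_zero`, `conj_areaInv`).

The CM evaluations (`A(Ω𝒪_K)⁻¹ = 2π/(|Ω|²√|d_K|)`, `A(𝔞⁻¹Λ)⁻¹ = N𝔞·A(Λ)⁻¹`, de Shalit's lattice
`𝔠⁻¹𝔪Ω` of II.3.5 (13)) are in the sequel `EisensteinNumbersAreaCM.lean`.

## References
* [deShalit1987] E. de Shalit, *Iwasawa theory of elliptic curves with complex multiplication*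
  (1987), II.2.1 (4)–(6) (p. 41), II.3.1 (6) (p. 50).
* [Rubin1999] K. Rubin, *Elliptic curves with complex multiplication and the conjecture of Birch
  and Swinnerton-Dyer*, LNM 1716, §7.4 Def. 7.9.
* [WhittakerWatson1927] E. T. Whittaker, G. N. Watson, *A Course of Modern Analysis*, §20.411
  (Legendre's relation).
* Mathlib: `PeriodPair`, `ZLattice.covolume`; tree: `EisensteinNumbers` (`areaInv`, `s₂`,
  `quasiPeriodMap_apply_eq`), `WeierstrassZetaLegendre` (`legendre_relation_holds`,
  `legendre_relation_of_neg`, `im_ω₂_div_ω₁_pos_or`).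
-/

noncomputable section

open Complex
open scoped ComplexConjugate

namespace PeriodPair

variable (L : PeriodPair)

/-! ### §1. `A(L)⁻¹ = π / Area(ℂ/L)` for every period pair -/

/-- The quasi-periods decomposed: `η₁ = s₂(L)·ω₁ + A(L)⁻¹·ω̄₁`. [cite: deShalit1987, II.2.1 (6)] -/
theorem η₁_eq_s₂_mul_add_areaInv_mul : L.η₁ = L.s₂ * L.ω₁ + L.areaInv * conj L.ω₁ := by
  rw [← quasiPeriodMap_ω₁, quasiPeriodMap_apply_eq]

/-- The quasi-periods decomposed: `η₂ = s₂(L)·ω₂ + A(L)⁻¹·ω̄₂`. [cite: deShalit1987, II.2.1 (6)] -/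
theorem η₂_eq_s₂_mul_add_areaInv_mul : L.η₂ = L.s₂ * L.ω₂ + L.areaInv * conj L.ω₂ := by
  rw [← quasiPeriodMap_ω₂, quasiPeriodMap_apply_eq]

/-- `η₁ω₂ − η₂ω₁ = A(L)⁻¹·(ω̄₁ω₂ − ω̄₂ω₁) = A(L)⁻¹ · 2i·Im(ω̄₁ω₂)` (de Shalit II.2.1 (4)/(6): the
`s₂`-parts cancel). [cite: deShalit1987, II.2.1 (4)–(6)] -/
theorem η₁_mul_ω₂_sub_η₂_mul_ω₁ :
    L.η₁ * L.ω₂ - L.η₂ * L.ω₁ = L.areaInv * ((2 * (conj L.ω₁ * L.ω₂).im : ℝ) * I) := by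
  have h : conj L.ω₂ * L.ω₁ = conj (conj L.ω₁ * L.ω₂) := by
    rw [map_mul, Complex.conj_conj, mul_comm]
  rw [η₁_eq_s₂_mul_add_areaInv_mul, η₂_eq_s₂_mul_add_areaInv_mul, ← Complex.sub_conj, ← h]
  ring

/-- `Im(ω̄₁ω₂)` and `Im(ω₂/ω₁)` have the same sign: `Im(ω₂/ω₁) = Im(ω̄₁ω₂)/|ω₁|²`. [folklore] -/
private theorem im_div_eq : (L.ω₂ / L.ω₁).im = (conj L.ω₁ * L.ω₂).im / Complex.normSq L.ω₁ := by
  rw [div_eq_mul_inv, Complex.inv_def, ← mul_assoc, mul_comm L.ω₂, Complex.mul_im,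
    Complex.ofReal_re, Complex.ofReal_im, mul_zero, zero_add, div_eq_mul_inv]

/-- `Im(ω̄₂ω₁) = −Im(ω̄₁ω₂)`. [folklore] -/
private theorem im_conj_mul_swap : (conj L.ω₂ * L.ω₁).im = -(conj L.ω₁ * L.ω₂).im := by
  have h : conj L.ω₂ * L.ω₁ = conj (conj L.ω₁ * L.ω₂) := by
    rw [map_mul, Complex.conj_conj, mul_comm]
  rw [h, Complex.conj_im]

/-- `Im(ω̄₁ω₂) ≠ 0`, i.e. `Area(ℂ/L) = |Im(ω̄₁ω₂)| ≠ 0` — the `ℝ`-linear independence of the two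
periods (so de Shalit's `A(L) = π⁻¹Area(ℂ/L)` is invertible). [cite: deShalit1987, II.2.1 (4)] -/
theorem im_conj_ω₁_mul_ω₂_ne_zero : (conj L.ω₁ * L.ω₂).im ≠ 0 := by
  have hω₁ : L.ω₁ ≠ 0 := by simpa using L.indep.ne_zero 0
  have hω₂ : L.ω₂ ≠ 0 := by simpa using L.indep.ne_zero 1
  rcases L.im_ω₂_div_ω₁_pos_or with h | h
  · rw [im_div_eq] at h
    intro h0
    rw [h0, zero_div] at h
    exact lt_irrefl _ h
  · have h' : (L.ω₁ / L.ω₂).im = (conj L.ω₂ * L.ω₁).im / Complex.normSq L.ω₂ := by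
      rw [div_eq_mul_inv, Complex.inv_def, ← mul_assoc, mul_comm L.ω₁, Complex.mul_im,
        Complex.ofReal_re, Complex.ofReal_im, mul_zero, zero_add, div_eq_mul_inv]
    rw [h', im_conj_mul_swap] at h
    intro h0
    rw [h0, neg_zero, zero_div] at h
    exact lt_irrefl _ h

/-- **de Shalit II.2.1 (4): `A(L)⁻¹ = π / Area(ℂ/L)`**, `Area(ℂ/L) = |Im(ω̄₁ω₂)|` — for EVERY period
pair (either orientation): from Legendre's relation `η₁ω₂ − η₂ω₁ = ±2πi` (sign = orientation, the
tree's `legendre_relation_holds` / `legendre_relation_of_neg`) and `η₁ω₂ − η₂ω₁ = A(L)⁻¹·2i·Im(ω̄₁ω₂)`.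
So the abstractly defined `PeriodPair.areaInv` IS de Shalit's `A(L)⁻¹` with
`A(L) = (2πi)⁻¹(ω₁ω̄₂ − ω̄₁ω₂) = π⁻¹Area(ℂ/L)` (positively oriented basis).
[cite: deShalit1987, II.2.1 (4)–(6)] [cite: WhittakerWatson1927, §20.411] -/
theorem areaInv_eq_pi_div_abs_im :
    L.areaInv = (Real.pi : ℂ) / (|(conj L.ω₁ * L.ω₂).im| : ℝ) := by
  have hω₁ : L.ω₁ ≠ 0 := by simpa using L.indep.ne_zero 0
  have hω₂ : L.ω₂ ≠ 0 := by simpa using L.indep.ne_zero 1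
  have hne := L.im_conj_ω₁_mul_ω₂_ne_zero
  have key := L.η₁_mul_ω₂_sub_η₂_mul_ω₁
  set w : ℝ := (conj L.ω₁ * L.ω₂).im with hw
  have hwC : ((2 * w : ℝ) : ℂ) * I ≠ 0 :=
    mul_ne_zero (by exact_mod_cast (mul_ne_zero two_ne_zero hne)) Complex.I_ne_zero
  rcases L.im_ω₂_div_ω₁_pos_or with h | h
  · -- positively oriented: `η₁ω₂ − η₂ω₁ = 2πi`, `Im(ω̄₁ω₂) > 0`
    have hpos : 0 < w := by
      rw [im_div_eq] at h
      exact (div_pos_iff_of_pos_right (Complex.normSq_pos.mpr hω₁)).mp h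
    have hleg : L.η₁ * L.ω₂ - L.η₂ * L.ω₁ = 2 * Real.pi * I := L.legendre_relation_holds h
    rw [hleg] at key
    rw [abs_of_pos hpos]
    -- `2πi = A⁻¹ · (2w) i` ⇒ `A⁻¹ = π/w`
    have hw0 : (w : ℂ) ≠ 0 := by exact_mod_cast hpos.ne'
    field_simp
    have : L.areaInv * (2 * (w : ℂ)) * I = 2 * (Real.pi : ℂ) * I := by
      rw [key]; push_cast; ring
    have h2 := mul_right_cancel₀ Complex.I_ne_zero this
    linear_combination (1 / 2 : ℂ) * h2
  · -- negatively oriented: `η₂ω₁ − η₁ω₂ = 2πi`, `Im(ω̄₁ω₂) < 0`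
    have hneg : w < 0 := by
      have h' : (L.ω₁ / L.ω₂).im = (conj L.ω₂ * L.ω₁).im / Complex.normSq L.ω₂ := by
        rw [div_eq_mul_inv, Complex.inv_def, ← mul_assoc, mul_comm L.ω₁, Complex.mul_im,
          Complex.ofReal_re, Complex.ofReal_im, mul_zero, zero_add, div_eq_mul_inv]
      rw [h', im_conj_mul_swap] at h
      have := (div_pos_iff_of_pos_right (Complex.normSq_pos.mpr hω₂)).mp h
      linarith
    have hleg : L.η₂ * L.ω₁ - L.η₁ * L.ω₂ = 2 * Real.pi * I := L.legendre_relation_of_neg h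
    have key' : L.areaInv * ((2 * w : ℝ) * I) = -(2 * Real.pi * I) := by
      rw [← key, ← hleg]; ring
    rw [abs_of_neg hneg]
    have hw0 : (w : ℂ) ≠ 0 := by exact_mod_cast hneg.ne
    push_cast
    field_simp
    have : L.areaInv * (2 * (w : ℂ)) * I = -(2 * (Real.pi : ℂ)) * I := by
      rw [show L.areaInv * (2 * (w : ℂ)) * I = L.areaInv * ((2 * w : ℝ) * I) by push_cast; ring,
        key']; ring
    have h2 := mul_right_cancel₀ Complex.I_ne_zero this
    linear_combination (1 / 2 : ℂ) * h2

/-- `A(L)⁻¹·|Im(ω̄₁ω₂)| = π`. [cite: deShalit1987, II.2.1 (4)] -/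
theorem areaInv_mul_abs_im_eq_pi : L.areaInv * (|(conj L.ω₁ * L.ω₂).im| : ℝ) = Real.pi := by
  have hne : ((|(conj L.ω₁ * L.ω₂).im| : ℝ) : ℂ) ≠ 0 := by
    exact_mod_cast (abs_pos.mpr L.im_conj_ω₁_mul_ω₂_ne_zero).ne'
  rw [areaInv_eq_pi_div_abs_im, div_mul_cancel₀ _ hne]

/-- **`A(L)⁻¹` is a positive real number** (`= π/Area(ℂ/L)`). [cite: deShalit1987, II.2.1 (4)] -/
theorem areaInv_eq_ofReal :
    ∃ r : ℝ, 0 < r ∧ L.areaInv = r := by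
  refine ⟨Real.pi / |(conj L.ω₁ * L.ω₂).im|,
    div_pos Real.pi_pos (abs_pos.mpr L.im_conj_ω₁_mul_ω₂_ne_zero), ?_⟩
  rw [areaInv_eq_pi_div_abs_im]; push_cast; rfl

/-- `A(L)⁻¹ ≠ 0`. [cite: deShalit1987, II.2.1 (4)] -/
theorem areaInv_ne_zero : L.areaInv ≠ 0 := by
  obtain ⟨r, hr, h⟩ := L.areaInv_eq_ofReal
  rw [h]; exact_mod_cast hr.ne'

/-- `A(L)⁻¹` is real: `conj A(L)⁻¹ = A(L)⁻¹`. [cite: deShalit1987, II.2.1 (4)] -/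
theorem conj_areaInv : conj L.areaInv = L.areaInv := by
  obtain ⟨r, -, h⟩ := L.areaInv_eq_ofReal
  rw [h, Complex.conj_ofReal]

/-- The Lebesgue area of a fundamental parallelogram of `Λ_L` in terms of the periods:
`covol(Λ_L) = |re ω₁ · im ω₂ − re ω₂ · im ω₁| = |Im(ω̄₁ω₂)|` (private copy of the tree's
`PeriodPair.covolume_lattice_eq`, `ComplexMultiplicationBurungaleFlachCorOneProofs`, to keep this
file's imports light). [folklore] -/
private theorem covolume_lattice_eq' :
    ZLattice.covolume L.lattice = |(conj L.ω₁ * L.ω₂).im| := by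
  have hvol : (MeasureTheory.volume : MeasureTheory.Measure ℂ).real
      (ZSpan.fundamentalDomain Complex.basisOneI) = 1 := by
    rw [MeasureTheory.measureReal_congr
        (ZSpan.fundamentalDomain_ae_parallelepiped Complex.basisOneI MeasureTheory.volume),
      MeasureTheory.measureReal_def, Complex.coe_basisOneI, ← Complex.coe_orthonormalBasisOneI,
      Complex.orthonormalBasisOneI.volume_parallelepiped, ENNReal.toReal_one]
  rw [ZLattice.covolume_eq_det_mul_measureReal L.lattice MeasureTheory.volume L.latticeBasis
      Complex.basisOneI, hvol, mul_one]
  have h1 : ((↑) : L.lattice → ℂ) ∘ L.latticeBasis = L.basis := by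
    ext i
    fin_cases i <;> simp
  rw [h1, Module.Basis.det_apply, Matrix.det_fin_two]
  simp [Module.Basis.toMatrix_apply, Complex.coe_basisOneI_repr]
  ring_nf

/-- **`A(L)⁻¹ · covol(Λ_L) = π`** — de Shalit's `A(L) = π⁻¹·Area(ℂ/L)` with Mathlib's
`ZLattice.covolume` (Lebesgue area of a fundamental parallelogram). [cite: deShalit1987, II.2.1 (4)] -/
theorem areaInv_mul_covolume_eq_pi :
    L.areaInv * (ZLattice.covolume L.lattice : ℂ) = Real.pi := by
  rw [covolume_lattice_eq', areaInv_mul_abs_im_eq_pi]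

/-- `A(L)⁻¹ = π / covol(Λ_L)`. [cite: deShalit1987, II.2.1 (4)] -/
theorem areaInv_eq_pi_div_covolume :
    L.areaInv = (Real.pi : ℂ) / (ZLattice.covolume L.lattice : ℝ) := by
  rw [covolume_lattice_eq', areaInv_eq_pi_div_abs_im]

end PeriodPair

end
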